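import Literature.Probability.LatticeModels.CriticalTwoPointLower
import Summits.CriticalPhenomena.Ising3DConformalLimit.Theorems.ReflectionTwinExistsContinuousLimitMmsFaces
import HarnessLib

/-!
# Exact lattice symmetry and MMS at the pinched disphenoid
(route ArmHyperscaling, crux `MergingFloor`, item stmt-CriticalPhenomena-15592, line
`xor-cluster-sign-bk`, registered stub `stub_disphenoidSymmetry`)

Statement (`stub_disphenoidSymmetry`): for integers `0 ≤ e ≤ n` and the four lattice points
`y₀ = (0,0,0)`, `y₁ = (0,e,n)`, `y₂ = (e,e,0)`, `y₃ = (e,0,n)` of `ℤ³`, with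
`G_{ij} = criticalCorr 3 2 ![yᵢ, yⱼ] = ⟨σ_{yᵢ}σ_{yⱼ}⟩⁺_{β_c}` the critical plus-state pair
correlation of the nearest-neighbour Ising model,

  `G₀₁ G₂₃ = G₀₃ G₁₂`  and  `G₀₁ G₂₃ ≤ G₀₂ G₁₃`.

Proof.  By translation invariance of the plus state (`plusPair_eq_twoPointPlus_sub`),
`G_{ij} = T(yⱼ - yᵢ)` with `T = criticalTwoPoint 3 = ⟨σ₀σ_·⟩⁺_{β_c}` (`corr_pair_eq`).  The six
differences are `y₁-y₀ = (0,e,n)`, `y₃-y₂ = (0,-e,n)`, `y₃-y₀ = (e,0,n)`, `y₂-y₁ = (e,0,-n)`,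
`y₂-y₀ = (e,e,0)`, `y₃-y₁ = (e,-e,0)`.  By the hyperoctahedral invariance of `T` (coordinate
reflections and coordinate permutations, Friedli–Velenik 2017, Exercise 3.14; the `![a,b,c]`-coordinate
forms `refl_one`, `refl_two`, `perm_01`, `perm_02`, `perm_12` of
`Theorems/ReflectionTwinExistsContinuousLimitMmsFaces.lean`) the first four all equal `A = T(0,e,n)`
and the last two equal `B = T(e,e,0)`; this gives the identity `A·A = A·A`.  For the inequality,
Messager–Miracle-Solé monotonicity along a coordinate axis (`messager_miracleSole_holds`, iterated
from coordinate value `e ≥ 0` up to `n = e + k`: `mms_one_iter`) gives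
`A = T(0,e,n) = T(0,n,e) ≤ T(0,e,e) = T(e,e,0) = B`; with `A ≥ 0` (Griffiths) this yields
`A·A ≤ B·B`.

References: A. Messager, S. Miracle-Solé, J. Stat. Phys. 17 (1977) 245; G. C. Hegerfeldt,
CMP 57 (1977) 259; S. Friedli, Y. Velenik, CUP 2017, §3.10.6, Exercise 3.14 and Thm. 3.17.
No definitions and no named facts are introduced.
-/

noncomputable section

namespace Summit.CriticalPhenomena.Ising3DConformalLimit.ArmHyperscalingMergingFloorXor

open Literature.Probability.LatticeModels
open Summit.CriticalPhenomena.Ising3DConformalLimit.ReflectionTwinExistsContinuousLimit.FreeBox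
  (refl_one refl_two perm_01 perm_02 perm_12 mms_one_iter)

/-- `criticalCorr d 2 ![a, b] = ⟨σ_a σ_b⟩⁺_{β_c} = ⟨σ₀ σ_{b-a}⟩⁺_{β_c}` (translation invariance of
the plus state, `plusPair_eq_twoPointPlus_sub`; Friedli–Velenik 2017, Thm. 3.17). [cite: FriedliVelenik2017, Thm. 3.17] -/
theorem corr_pair_eq {d : ℕ} (a b : Site d) :
    criticalCorr d 2 ![a, b] = criticalTwoPoint d (b - a) := by
  -- adapted from `criticalCorr_two_pair` (Literature/Probability/LatticeModels/HighDimPointwiseTriviality.lean)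
  have h1 : criticalCorr d 2 ![a, b] = plusPair d (criticalBeta d) a b := by
    change plusExpect d (criticalBeta d) 0 (spinMonomial ![a, b]) =
      plusExpect d (criticalBeta d) 0 (spinPair a b)
    congr 1
    funext s
    simp [spinMonomial, spinPair, Fin.prod_univ_two]
  rw [h1, plusPair_eq_twoPointPlus_sub (criticalBeta_nonneg d)]
  rfl

/-- **Exact lattice symmetry and MMS at the disphenoid** (registered stub `stub_disphenoidSymmetry`
of line `xor-cluster-sign-bk`; `0 ≤ e ≤ n`; `y₀ = (0,0,0)`, `y₁ = (0,e,n)`, `y₂ = (e,e,0)`,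
`y₃ = (e,0,n)`; `G = criticalCorr 3 2`): `G₀₁G₂₃ = G₀₃G₁₂` (all four factors equal `⟨σ₀σ_{(0,e,n)}⟩⁺_{β_c}`
by translation and hyperoctahedral invariance) and `G₀₁G₂₃ ≤ G₀₂G₁₃` (Messager–Miracle-Solé along a
coordinate axis: `⟨σ₀σ_{(0,e,n)}⟩ ≤ ⟨σ₀σ_{(0,e,e)}⟩ = ⟨σ₀σ_{(e,e,0)}⟩`, and `G₀₂ = G₁₃ = ⟨σ₀σ_{(e,e,0)}⟩`).
[cite: MessagerMiracleSoleJSP1977, main theorem] -/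
theorem stub_disphenoidSymmetry : ∀ (e n : ℤ), 0 ≤ e → e ≤ n →
    criticalCorr 3 2 ![![0, 0, 0], ![0, e, n]] * criticalCorr 3 2 ![![e, e, 0], ![e, 0, n]] =
      criticalCorr 3 2 ![![0, 0, 0], ![e, 0, n]] * criticalCorr 3 2 ![![0, e, n], ![e, e, 0]] ∧
    criticalCorr 3 2 ![![0, 0, 0], ![0, e, n]] * criticalCorr 3 2 ![![e, e, 0], ![e, 0, n]] ≤
      criticalCorr 3 2 ![![0, 0, 0], ![e, e, 0]] * criticalCorr 3 2 ![![0, e, n], ![e, 0, n]] := by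
  intro e n he hen
  -- the six pair correlators as two-point functions of differences
  have h01 : criticalCorr 3 2 ![![0, 0, 0], ![0, e, n]] = criticalTwoPoint 3 ![0, e, n] := by
    rw [corr_pair_eq]; congr 1; funext j; fin_cases j <;> simp
  have h23 : criticalCorr 3 2 ![![e, e, 0], ![e, 0, n]] = criticalTwoPoint 3 ![0, -e, n] := by
    rw [corr_pair_eq]; congr 1; funext j; fin_cases j <;> simp
  have h03 : criticalCorr 3 2 ![![0, 0, 0], ![e, 0, n]] = criticalTwoPoint 3 ![e, 0, n] := by
    rw [corr_pair_eq]; congr 1; funext j; fin_cases j <;> simp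
  have h12 : criticalCorr 3 2 ![![0, e, n], ![e, e, 0]] = criticalTwoPoint 3 ![e, 0, -n] := by
    rw [corr_pair_eq]; congr 1; funext j; fin_cases j <;> simp
  have h02 : criticalCorr 3 2 ![![0, 0, 0], ![e, e, 0]] = criticalTwoPoint 3 ![e, e, 0] := by
    rw [corr_pair_eq]; congr 1; funext j; fin_cases j <;> simp
  have h13 : criticalCorr 3 2 ![![0, e, n], ![e, 0, n]] = criticalTwoPoint 3 ![e, -e, 0] := by
    rw [corr_pair_eq]; congr 1; funext j; fin_cases j <;> simp
  -- hyperoctahedral symmetry: the four `A = T(0,e,n)` values and the two `B = T(e,e,0)` values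
  have s23 : criticalTwoPoint 3 ![0, -e, n] = criticalTwoPoint 3 ![0, e, n] := refl_one 0 e n
  have s03 : criticalTwoPoint 3 ![e, 0, n] = criticalTwoPoint 3 ![0, e, n] := perm_01 0 e n
  have s12 : criticalTwoPoint 3 ![e, 0, -n] = criticalTwoPoint 3 ![0, e, n] := by
    rw [refl_two e 0 n, perm_01 0 e n]
  have s13 : criticalTwoPoint 3 ![e, -e, 0] = criticalTwoPoint 3 ![e, e, 0] := refl_one e e 0
  rw [h01, h23, h03, h12, h02, h13, s23, s03, s12, s13]
  refine ⟨rfl, ?_⟩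
  -- MMS along a coordinate axis: `T(0,e,n) = T(0,n,e) ≤ T(0,e,e) = T(e,e,0)` with `n = e + k`
  obtain ⟨k, hk⟩ := Int.le.dest hen
  have hA : criticalTwoPoint 3 ![0, e, n] ≤ criticalTwoPoint 3 ![e, e, 0] := by
    rw [← hk, perm_02 0 e e, perm_12 0 (e + (k : ℤ)) e]
    exact mms_one_iter 0 he e k
  have hA0 : 0 ≤ criticalTwoPoint 3 ![0, e, n] :=
    twoPointPlus_nonneg_of_gks (criticalBeta_nonneg 3) _
  exact mul_le_mul hA hA hA0 (hA0.trans hA)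

end Summit.CriticalPhenomena.Ising3DConformalLimit.ArmHyperscalingMergingFloorXor
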